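import Summits.Ventures.PercRepro.RankLevelSetBasesLower

/-!
# PercRepro — how many `k`-element cocircuits (dually: `k`-element circuits) a finite matroid can have (night-1, gen 2)

`proofs/NIGHT-1-C025-induction.md` §13.4, «the 4-circuit count by the dual, with classes» — the last step of residue
(R1) of THEOREM E that was paper only. Let `M` be a finite matroid of rank `ν` and let `R ⊆ M.E` be a set of
representatives of the parallel classes (nonloops, one from each class, no two parallel). The complement
`H = M.E ∖ K` of a cocircuit `K` is a flat of rank `ν − 1` spanned by `H ∩ R`; every independent `(ν − 1)`-subset `J`
of `H ∩ R` has closure `H`, so `K = M.E ∖ closure J` is determined by `J`; and by LEMMA m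
(`choose_two_le_ncard_isBase`, RankLevelSetBasesLower) applied to the simple matroid `M.restrict (H ∩ R)` there are at least
`C(|R ∖ K| − (ν − 1) + 2, 2)` such `J`. Counting the independent `(ν − 1)`-subsets of `R` once:

  `#{cocircuits with k elements} · C(|R| − k − (ν − 1) + 2, 2) ≤ C(|R|, ν − 1)`.

Applied to `M✶` (its cocircuits are the circuits of `M`, its parallel classes the series classes of `M`) this is the
dossier's count of `4`-circuits: a finite matroid on at most `16` elements of nullity `≤ 4` has at most `35`
four-element circuits (`≤ 70` on `≤ 20` elements at nullity `≤ 5`; `≤ 312` on `≤ 24` elements at nullity `≤ 6`) —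
the constants of the §13.4 referee note (`s₄ ≤ 35 / 70 / 312` at `ν(S₀) ≤ 4 / 5 / 6`, `|S₀| ≤ 4·ν(S₀)`).

* `IsCocircuit.closure_compl_eq` — the complement of a cocircuit is closed;
* `IsCocircuit.eRk_compl_add_one`, `IsCocircuit.eRk_compl_eq` — and has rank `r(M) − 1`;
* `eRk_inter_eq_of_closure_eq` — a flat is spanned by its representatives;
* `three_le_encard_of_isCircuit_restrict` — the restriction to representatives is simple;
* `exists_parallel_reps` — a set of representatives exists;
* **`ncard_isCocircuit_mul_choose_le`** — the count;
* **`ncard_isCircuit_mul_choose_le`** — its dual form, for circuits;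
* `ncard_isCircuit_four_le_of_nullity_le_four` / `…_five` / `…_six` — the numbers `35 / 70 / 312`;
* `ncard_isCircuit_four_le_of_subset_nullity_le_four` / `…_five` / `…_six` — the same for the `4`-circuits of `M`
  when they all lie in a set `S` of bounded size and nullity (the dossier's `S₀`).
Axioms: standard.
-/

namespace PercRepro

namespace Matroid

open Set

variable {α : Type*} {M : _root_.Matroid α}

/-- `M.E ∖ (K ∖ {e}) = insert e (M.E ∖ K)` for `e ∈ M.E`. -/
theorem ground_sdiff_sdiff_singleton {K : Set α} {e : α} (heE : e ∈ M.E) :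
    M.E \ (K \ {e}) = insert e (M.E \ K) := by
  rw [sdiff_sdiff_right, inter_singleton_of_mem heE, union_singleton]

/-- **The complement of a cocircuit is a flat.** -/
theorem IsCocircuit.closure_compl_eq {K : Set α} (hK : M.IsCocircuit K) :
    M.closure (M.E \ K) = M.E \ K := by
  rw [_root_.Matroid.isCocircuit_iff_minimal_compl_nonspanning] at hK
  refine subset_antisymm ?_ (M.subset_closure _ sdiff_subset)
  intro e he
  have heE : e ∈ M.E := M.closure_subset_ground _ he
  by_contra heH
  have heK : e ∈ K := by
    by_contra h
    exact heH ⟨heE, h⟩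
  have hP : ¬ M.Spanning (M.E \ (K \ {e})) := by
    rw [ground_sdiff_sdiff_singleton heE,
      _root_.Matroid.spanning_iff_closure_eq (insert_subset heE sdiff_subset),
      _root_.Matroid.closure_insert_eq_of_mem_closure he]
    have h1 : ¬ M.Spanning (M.E \ K) := hK.1
    rwa [_root_.Matroid.spanning_iff_closure_eq sdiff_subset] at h1
  have hle := hK.2 hP sdiff_subset
  exact (hle heK).2 rfl

/-- **The complement of a cocircuit has rank `r(M) − 1`**: `r(E ∖ K) + 1 = r(M)`. -/
theorem IsCocircuit.eRk_compl_add_one [M.RankFinite] {K : Set α} (hK : M.IsCocircuit K) :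
    M.eRk (M.E \ K) + 1 = M.eRank := by
  obtain ⟨e, heK⟩ := hK.nonempty
  have heE : e ∈ M.E := hK.subset_ground heK
  have hK' := hK
  rw [_root_.Matroid.isCocircuit_iff_minimal_compl_nonspanning] at hK'
  have hsp : M.Spanning (insert e (M.E \ K)) := by
    by_contra h
    have hP : ¬ M.Spanning (M.E \ (K \ {e})) := by
      rwa [ground_sdiff_sdiff_singleton heE]
    have := hK'.2 hP sdiff_subset
    exact (this heK).2 rfl
  have hlt : M.eRk (M.E \ K) < M.eRank := by
    have h1 : ¬ M.Spanning (M.E \ K) := hK'.1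
    rw [_root_.Matroid.spanning_iff_eRk_le sdiff_subset] at h1
    exact lt_of_not_ge h1
  have hle : M.eRank ≤ M.eRk (M.E \ K) + 1 := by
    rw [← hsp.eRk_eq]
    exact M.eRk_insert_le_add_one e _
  refine le_antisymm ?_ hle
  exact (ENat.add_one_le_iff (ne_top_of_lt hlt)).2 hlt

/-- The same with the rank `ν` of `M` read as a natural number: `ν ≥ 1` and `r(E ∖ K) = ν − 1`. -/
theorem IsCocircuit.eRk_compl_eq [M.RankFinite] {K : Set α} (hK : M.IsCocircuit K) {ν : ℕ}
    (hν : M.eRank = (ν : ℕ∞)) : 1 ≤ ν ∧ M.eRk (M.E \ K) = ((ν - 1 : ℕ) : ℕ∞) := by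
  have hrk1 := IsCocircuit.eRk_compl_add_one hK
  have hne : M.eRk (M.E \ K) ≠ ⊤ := by
    intro h
    rw [h, top_add, hν] at hrk1
    exact ENat.coe_ne_top ν hrk1.symm
  obtain ⟨m, hm⟩ := ENat.ne_top_iff_exists.1 hne
  rw [← hm, hν] at hrk1
  have hmν : m + 1 = ν := by exact_mod_cast hrk1
  refine ⟨by omega, ?_⟩
  rw [← hm]
  exact_mod_cast (by omega : m = ν - 1)

/-- If `R` meets every parallel class (every nonloop `e` lies in the closure of some `r ∈ R`), a flat `F` is spanned
by `F ∩ R`. -/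
theorem eRk_inter_eq_of_closure_eq {R F : Set α}
    (hR1 : ∀ e, M.IsNonloop e → ∃ r ∈ R, e ∈ M.closure {r}) (hF : M.closure F = F) :
    M.eRk (F ∩ R) = M.eRk F := by
  have hFE : F ⊆ M.E := hF ▸ M.closure_subset_ground F
  have hsub : F ⊆ M.closure (F ∩ R) := by
    intro e he
    by_cases hl : M.IsLoop e
    · exact hl.mem_closure _
    have hne : M.IsNonloop e := ⟨hl, hFE he⟩
    obtain ⟨r, hrR, her⟩ := hR1 e hne
    have hre : r ∈ M.closure {e} := hne.mem_closure_singleton her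
    have hrF : r ∈ F := by
      rw [← hF]
      exact M.closure_subset_closure (singleton_subset_iff.2 he) hre
    exact M.closure_subset_closure (singleton_subset_iff.2 (mem_inter hrF hrR)) her
  refine le_antisymm (M.eRk_mono inter_subset_left) ?_
  calc M.eRk F ≤ M.eRk (M.closure (F ∩ R)) := M.eRk_mono hsub
    _ = M.eRk (F ∩ R) := M.eRk_closure_eq _

/-- The restriction of `M` to a set of pairwise non-parallel nonloops is simple: every circuit has `≥ 3` elements. -/
theorem three_le_encard_of_isCircuit_restrict {R X : Set α} (hXR : X ⊆ R)
    (hR0 : ∀ r ∈ R, M.IsNonloop r) (hR2 : ∀ r ∈ R, ∀ s ∈ R, r ∈ M.closure {s} → r = s) {C : Set α}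
    (hC : (M.restrict X).IsCircuit C) : 3 ≤ C.encard := by
  have hXE : X ⊆ M.E := fun x hx => (hR0 x (hXR hx)).mem_ground
  rw [_root_.Matroid.restrict_isCircuit_iff hXE] at hC
  obtain ⟨hC, hCX⟩ := hC
  by_contra hlt
  rw [not_le] at hlt
  have h2 : C.encard ≤ 2 := by
    have h3 : (3 : ℕ∞) = 2 + 1 := by norm_num
    rw [h3, ENat.lt_add_one_iff (by simp)] at hlt
    exact hlt
  rcases h2.lt_or_eq with h1 | h1
  · have h1' : C.encard ≤ 1 := by
      have h2' : (2 : ℕ∞) = 1 + 1 := by norm_num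
      rw [h2', ENat.lt_add_one_iff (by simp)] at h1
      exact h1
    rcases Set.encard_le_one_iff_eq.1 h1' with h0 | ⟨x, rfl⟩
    · exact hC.nonempty.ne_empty h0
    · exact (hR0 x (hXR (hCX rfl))).not_isLoop (_root_.Matroid.singleton_isCircuit.1 hC)
  · obtain ⟨x, y, hxy, rfl⟩ := Set.encard_eq_two.1 h1
    have hx : x ∈ M.closure ({x, y} \ {x}) := by
      rw [hC.closure_sdiff_singleton_eq]
      exact M.subset_closure _ hC.subset_ground (by simp)
    rw [Set.pair_sdiff_left hxy] at hx
    exact hxy (hR2 x (hXR (hCX (by simp))) y (hXR (hCX (by simp))) hx)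

/-- A set of representatives of the parallel classes exists: `R ⊆ M.E` consists of nonloops, meets every class, and
has no two distinct parallel elements. -/
theorem exists_parallel_reps (M : _root_.Matroid α) :
    ∃ R ⊆ M.E, (∀ r ∈ R, M.IsNonloop r) ∧ (∀ e, M.IsNonloop e → ∃ r ∈ R, e ∈ M.closure {r}) ∧
      (∀ r ∈ R, ∀ s ∈ R, r ∈ M.closure {s} → r = s) := by
  classical
  let Cl : Set (Set α) := {F | ∃ e, M.IsNonloop e ∧ M.closure {e} = F}
  let rep : Cl → α := fun F => Classical.choose F.2
  have hrep : ∀ F : Cl, M.IsNonloop (rep F) ∧ M.closure {rep F} = F.1 :=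
    fun F => Classical.choose_spec F.2
  refine ⟨Set.range rep, ?_, ?_, ?_, ?_⟩
  · rintro _ ⟨F, rfl⟩
    exact (hrep F).1.mem_ground
  · rintro _ ⟨F, rfl⟩
    exact (hrep F).1
  · intro e he
    refine ⟨rep ⟨M.closure {e}, e, he, rfl⟩, ⟨_, rfl⟩, ?_⟩
    rw [(hrep ⟨M.closure {e}, e, he, rfl⟩).2]
    exact M.mem_closure_self e he.mem_ground
  · rintro _ ⟨F, rfl⟩ _ ⟨G, rfl⟩ h
    have hFG : F = G := by
      apply Subtype.ext
      rw [← (hrep F).2, ← (hrep G).2]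
      exact (hrep F).1.closure_eq_of_mem_closure h
    rw [hFG]

/-- **THE COCIRCUIT COUNT.** For a finite matroid `M` of rank `ν` and a set `R` of representatives of its parallel
classes, `#{cocircuits with k elements} · C(|R| − k − (ν − 1) + 2, 2) ≤ C(|R|, ν − 1)`: every independent
`(ν − 1)`-subset `J` of `R` determines at most one cocircuit `K` (the one with `M.E ∖ K = closure J`), and each
`k`-cocircuit `K` is determined by at least `C(|R ∖ K| − (ν − 1) + 2, 2)` of them (LEMMA m on `M.restrict ((M.E ∖ K) ∩ R)`). -/
theorem ncard_isCocircuit_mul_choose_le (M : _root_.Matroid α) [M.Finite] {R : Set α} (hR : R ⊆ M.E)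
    (hR0 : ∀ r ∈ R, M.IsNonloop r) (hR1 : ∀ e, M.IsNonloop e → ∃ r ∈ R, e ∈ M.closure {r})
    (hR2 : ∀ r ∈ R, ∀ s ∈ R, r ∈ M.closure {s} → r = s) {ν : ℕ} (hν : M.eRank = (ν : ℕ∞)) (k : ℕ) :
    {K | M.IsCocircuit K ∧ K.ncard = k}.ncard * (R.ncard - k - (ν - 1) + 2).choose 2 ≤
      R.ncard.choose (ν - 1) := by
  classical
  have hRfin : R.Finite := M.ground_finite.subset hR
  set 𝒥 : Set (Set α) := {J | J ⊆ R ∧ M.Indep J ∧ J.ncard = ν - 1} with h𝒥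
  set 𝒦 : Set (Set α) := {K | M.IsCocircuit K ∧ K.ncard = k} with h𝒦
  have h𝒥fin : 𝒥.Finite := hRfin.finite_subsets.subset (fun J hJ => hJ.1)
  have h𝒦fin : 𝒦.Finite := M.ground_finite.finite_subsets.subset (fun K hK => hK.1.subset_ground)
  let f : Set α → Set α := fun J => M.E \ M.closure J
  -- every base of `M.restrict ((M.E ∖ K) ∩ R)` is an independent `(ν − 1)`-subset of `R` in the fibre over `K`
  have key : ∀ K ∈ 𝒦, ∀ B, (M.restrict ((M.E \ K) ∩ R)).IsBase B → B ∈ 𝒥 ∧ f B = K := by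
    intro K hK B hB
    have hKc : M.IsCocircuit K := hK.1
    have hX : (M.E \ K) ∩ R ⊆ M.E := inter_subset_left.trans sdiff_subset
    rw [_root_.Matroid.isBase_restrict_iff hX] at hB
    have hBR : B ⊆ R := hB.subset.trans inter_subset_right
    have hBfin : B.Finite := hRfin.subset hBR
    have hH : M.closure (M.E \ K) = M.E \ K := IsCocircuit.closure_compl_eq hKc
    have hrk : M.eRk ((M.E \ K) ∩ R) = M.eRk (M.E \ K) := eRk_inter_eq_of_closure_eq hR1 hH
    obtain ⟨hν1, hrkH⟩ := IsCocircuit.eRk_compl_eq hKc hν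
    have hBcard : B.ncard = ν - 1 := by
      have h1 : B.encard = ((ν - 1 : ℕ) : ℕ∞) := by
        rw [← hB.eRk_eq_encard, hrk, hrkH]
      have h2 : (B.ncard : ℕ∞) = ((ν - 1 : ℕ) : ℕ∞) := by rw [hBfin.cast_ncard_eq, h1]
      exact_mod_cast h2
    have hclB : M.closure B = M.E \ K := by
      have hBH : B ⊆ M.E \ K := hB.subset.trans inter_subset_left
      have hrkB : M.eRk (M.E \ K) ≤ M.eRk B := by
        rw [hB.indep.eRk_eq_encard, ← hBfin.cast_ncard_eq, hBcard, hrkH]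
      rw [(M.isRkFinite_of_finite hBfin).closure_eq_closure_of_subset_of_eRk_ge_eRk hBH hrkB, hH]
    refine ⟨⟨hBR, hB.indep, hBcard⟩, ?_⟩
    show M.E \ M.closure B = K
    rw [hclB, sdiff_sdiff_cancel_left hKc.subset_ground]
  -- LEMMA m: the fibre over `K` has at least `C(|R| − k − (ν − 1) + 2, 2)` elements
  have fibre : ∀ K ∈ 𝒦, (R.ncard - k - (ν - 1) + 2).choose 2 ≤
      {B | (M.restrict ((M.E \ K) ∩ R)).IsBase B}.ncard := by
    intro K hK
    have hKc : M.IsCocircuit K := hK.1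
    have hX : (M.E \ K) ∩ R ⊆ M.E := inter_subset_left.trans sdiff_subset
    haveI : (M.restrict ((M.E \ K) ∩ R)).Finite :=
      _root_.Matroid.restrict_finite (M.ground_finite.subset hX)
    have hsimple : ∀ C, (M.restrict ((M.E \ K) ∩ R)).IsCircuit C → 3 ≤ C.encard :=
      fun C hC => three_le_encard_of_isCircuit_restrict inter_subset_right hR0 hR2 hC
    have hrank : (M.restrict ((M.E \ K) ∩ R)).eRank = ((ν - 1 : ℕ) : ℕ∞) := by
      rw [_root_.Matroid.eRank_restrict, eRk_inter_eq_of_closure_eq hR1 (IsCocircuit.closure_compl_eq hKc),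
        (IsCocircuit.eRk_compl_eq hKc hν).2]
    have hm := choose_two_le_ncard_isBase hsimple hrank
    refine le_trans (Nat.choose_le_choose 2 ?_) hm
    rw [_root_.Matroid.restrict_ground_eq]
    have hXR : (M.E \ K) ∩ R = R \ K := by
      ext x
      simp only [mem_inter_iff, mem_sdiff]
      exact ⟨fun h => ⟨h.2, h.1.2⟩, fun h => ⟨⟨hR h.1, h.2⟩, h.1⟩⟩
    rw [hXR]
    have h1 : R.ncard - K.ncard ≤ (R \ K).ncard :=
      le_ncard_sdiff K R (M.ground_finite.subset hKc.subset_ground)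
    rw [hK.2] at h1
    omega
  -- double counting on finsets
  let s : Finset (Set α) := h𝒥fin.toFinset
  let t : Finset (Set α) := h𝒦fin.toFinset
  let s' : Finset (Set α) := s.filter (fun J => f J ∈ t)
  have hmaps : ∀ J ∈ s', f J ∈ t := fun J hJ => (Finset.mem_filter.1 hJ).2
  have hfib : ∀ K ∈ t, (R.ncard - k - (ν - 1) + 2).choose 2 ≤
      (s'.filter (fun J => f J = K)).card := by
    intro K hKt
    have hK : K ∈ 𝒦 := h𝒦fin.mem_toFinset.1 hKt
    have hBfin : {B | (M.restrict ((M.E \ K) ∩ R)).IsBase B}.Finite := by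
      refine hRfin.finite_subsets.subset (fun B hB => ?_)
      have h := _root_.Matroid.IsBase.subset_ground
        (show (M.restrict ((M.E \ K) ∩ R)).IsBase B from hB)
      rw [_root_.Matroid.restrict_ground_eq] at h
      exact h.trans inter_subset_right
    refine le_trans (fibre K hK) ?_
    rw [Set.ncard_eq_toFinset_card _ hBfin]
    apply Finset.card_le_card
    intro B hB
    rw [Set.Finite.mem_toFinset] at hB
    obtain ⟨hB𝒥, hfB⟩ := key K hK B hB
    rw [Finset.mem_filter, Finset.mem_filter, Set.Finite.mem_toFinset]
    exact ⟨⟨hB𝒥, hfB ▸ hKt⟩, hfB⟩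
  have hmain := Finset.mul_card_image_le_card_of_maps_to hmaps _ hfib
  have hs' : s'.card ≤ s.card := Finset.card_filter_le _ _
  have hs : s.card ≤ R.ncard.choose (ν - 1) := by
    rw [← Set.ncard_eq_toFinset_card _ h𝒥fin, ← Set.ncard_powerset_ncard hRfin (ν - 1)]
    exact Set.ncard_le_ncard (fun J hJ => ⟨hJ.1, hJ.2.2⟩)
      (hRfin.finite_subsets.subset (fun J hJ => hJ.1))
  have ht : 𝒦.ncard = t.card := Set.ncard_eq_toFinset_card _ h𝒦fin
  rw [ht, mul_comm]
  exact hmain.trans (hs'.trans hs)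

/-- **THE CIRCUIT COUNT** (dual form). For a finite matroid `M` of nullity `ν` (`M✶.eRank = ν`) and a set `R` of
representatives of the series classes of `M` (the parallel classes of `M✶`),
`#{circuits with k elements} · C(|R| − k − (ν − 1) + 2, 2) ≤ C(|R|, ν − 1)`. -/
theorem ncard_isCircuit_mul_choose_le (M : _root_.Matroid α) [M.Finite] {R : Set α} (hR : R ⊆ M.E)
    (hR0 : ∀ r ∈ R, M✶.IsNonloop r) (hR1 : ∀ e, M✶.IsNonloop e → ∃ r ∈ R, e ∈ M✶.closure {r})
    (hR2 : ∀ r ∈ R, ∀ s ∈ R, r ∈ M✶.closure {s} → r = s) {ν : ℕ} (hν : M✶.eRank = (ν : ℕ∞))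
    (k : ℕ) :
    {C | M.IsCircuit C ∧ C.ncard = k}.ncard * (R.ncard - k - (ν - 1) + 2).choose 2 ≤
      R.ncard.choose (ν - 1) := by
  have hR' : R ⊆ M✶.E := by rwa [_root_.Matroid.dual_ground]
  have h := ncard_isCocircuit_mul_choose_le M✶ hR' hR0 hR1 hR2 hν k
  simpa only [_root_.Matroid.dual_isCocircuit_iff] using h

/-- The circuit count with the representatives chosen: for a finite matroid of nullity `ν` there is `c ≤ |E|` with
`#{circuits with k elements} · C(c − k − (ν − 1) + 2, 2) ≤ C(c, ν − 1)`. -/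
theorem exists_ncard_isCircuit_mul_choose_le (M : _root_.Matroid α) [M.Finite] {ν : ℕ}
    (hν : M✶.eRank = (ν : ℕ∞)) (k : ℕ) :
    ∃ c ≤ M.E.ncard, {C | M.IsCircuit C ∧ C.ncard = k}.ncard * (c - k - (ν - 1) + 2).choose 2 ≤
      c.choose (ν - 1) := by
  obtain ⟨R, hR, hR0, hR1, hR2⟩ := exists_parallel_reps M✶
  rw [_root_.Matroid.dual_ground] at hR
  exact ⟨R.ncard, Set.ncard_le_ncard hR M.ground_finite,
    ncard_isCircuit_mul_choose_le M hR hR0 hR1 hR2 hν k⟩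

/-- A finite nullity as a natural number: `M✶.eRank ≤ n` gives `ν ≤ n` with `M✶.eRank = ν`. -/
theorem exists_nullity_eq_of_le (M : _root_.Matroid α) {n : ℕ} (hν : M✶.eRank ≤ (n : ℕ∞)) :
    ∃ ν : ℕ, ν ≤ n ∧ M✶.eRank = (ν : ℕ∞) := by
  have hfin : M✶.eRank ≠ ⊤ := ne_top_of_le_ne_top (ENat.coe_ne_top n) hν
  obtain ⟨ν, hν'⟩ := ENat.ne_top_iff_exists.1 hfin
  refine ⟨ν, ?_, hν'.symm⟩
  rw [← hν'] at hν
  exact_mod_cast hν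

/-- **Four-element circuits at nullity `≤ 4`**: a finite matroid on at most `16` elements with `M✶.eRank ≤ 4` has at
most `35` four-element circuits (`35 = C(7, 3)`, the value at `c = 7` series classes). -/
theorem ncard_isCircuit_four_le_of_nullity_le_four (M : _root_.Matroid α) [M.Finite]
    (hE : M.E.ncard ≤ 16) (hν : M✶.eRank ≤ 4) :
    {C | M.IsCircuit C ∧ C.ncard = 4}.ncard ≤ 35 := by
  obtain ⟨ν, hν4, hν'⟩ := exists_nullity_eq_of_le M (n := 4) (by exact_mod_cast hν)
  obtain ⟨c, hc, h⟩ := exists_ncard_isCircuit_mul_choose_le M hν' 4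
  have hc' : c ≤ 16 := hc.trans hE
  generalize {C | M.IsCircuit C ∧ C.ncard = 4}.ncard = s at h ⊢
  interval_cases ν <;> interval_cases c <;>
    norm_num [Nat.choose_eq_factorial_div_factorial, Nat.factorial, Nat.choose_two_right,
      Nat.choose_eq_zero_of_lt] at h ⊢ <;> omega

/-- **Four-element circuits at nullity `≤ 5`**: on at most `20` elements, at most `70` four-element circuits
(`70 = C(8, 4)`, at `c = 8`). -/
theorem ncard_isCircuit_four_le_of_nullity_le_five (M : _root_.Matroid α) [M.Finite]
    (hE : M.E.ncard ≤ 20) (hν : M✶.eRank ≤ 5) :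
    {C | M.IsCircuit C ∧ C.ncard = 4}.ncard ≤ 70 := by
  obtain ⟨ν, hν5, hν'⟩ := exists_nullity_eq_of_le M (n := 5) (by exact_mod_cast hν)
  obtain ⟨c, hc, h⟩ := exists_ncard_isCircuit_mul_choose_le M hν' 4
  have hc' : c ≤ 20 := hc.trans hE
  generalize {C | M.IsCircuit C ∧ C.ncard = 4}.ncard = s at h ⊢
  interval_cases ν <;> interval_cases c <;>
    norm_num [Nat.choose_eq_factorial_div_factorial, Nat.factorial, Nat.choose_two_right,
      Nat.choose_eq_zero_of_lt] at h ⊢ <;> omega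

/-- **Four-element circuits at nullity `≤ 6`**: on at most `24` elements, at most `312` four-element circuits
(`312 = ⌊C(24, 5) / C(17, 2)⌋`, at `c = 24`). -/
theorem ncard_isCircuit_four_le_of_nullity_le_six (M : _root_.Matroid α) [M.Finite]
    (hE : M.E.ncard ≤ 24) (hν : M✶.eRank ≤ 6) :
    {C | M.IsCircuit C ∧ C.ncard = 4}.ncard ≤ 312 := by
  obtain ⟨ν, hν6, hν'⟩ := exists_nullity_eq_of_le M (n := 6) (by exact_mod_cast hν)
  obtain ⟨c, hc, h⟩ := exists_ncard_isCircuit_mul_choose_le M hν' 4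
  have hc' : c ≤ 24 := hc.trans hE
  generalize {C | M.IsCircuit C ∧ C.ncard = 4}.ncard = s at h ⊢
  interval_cases ν <;> interval_cases c <;>
    norm_num [Nat.choose_eq_factorial_div_factorial, Nat.factorial, Nat.choose_two_right,
      Nat.choose_eq_zero_of_lt] at h ⊢ <;> omega

/-- The `k`-element circuits of `M` all lying inside `S` are exactly the `k`-element circuits of `M.restrict S`. -/
theorem setOf_isCircuit_ncard_restrict_eq {S : Set α} (hS : S ⊆ M.E) {k : ℕ}
    (hcov : ∀ C, M.IsCircuit C → C.ncard = k → C ⊆ S) :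
    {C | (M.restrict S).IsCircuit C ∧ C.ncard = k} = {C | M.IsCircuit C ∧ C.ncard = k} := by
  ext C
  simp only [mem_setOf_eq, _root_.Matroid.restrict_isCircuit_iff hS]
  exact ⟨fun h => ⟨h.1.1, h.2⟩, fun h => ⟨⟨h.1, hcov C h.1 h.2⟩, h.2⟩⟩

/-- The nullity of a restriction: `|S| ≤ r(S) + d` gives `(M.restrict S)✶.eRank ≤ d`. -/
theorem dual_eRank_restrict_le [M.Finite] {S : Set α} (hS : S ⊆ M.E) {d : ℕ}
    (hν : S.encard ≤ M.eRk S + d) : (M.restrict S)✶.eRank ≤ d := by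
  have h := _root_.Matroid.eRank_add_eRank_dual (M.restrict S)
  rw [_root_.Matroid.restrict_ground_eq, _root_.Matroid.eRank_restrict] at h
  have hfin : M.eRk S ≠ ⊤ := ne_top_of_le_ne_top ((M.ground_finite.subset hS).encard_lt_top.ne)
    (M.eRk_le_encard S)
  rw [← h] at hν
  exact (WithTop.add_le_add_iff_left hfin).1 hν

/-- **The dossier's form** (§13.4, the `d = 5` cell): if every `4`-element circuit of `M` lies in a set `S` with at
most `16` elements and nullity at most `4` (`|S| ≤ r(S) + 4`), then `M` has at most `35` four-element circuits. -/
theorem ncard_isCircuit_four_le_of_subset_nullity_le_four (M : _root_.Matroid α) [M.Finite] {S : Set α}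
    (hS : S ⊆ M.E) (hcov : ∀ C, M.IsCircuit C → C.ncard = 4 → C ⊆ S) (hSc : S.ncard ≤ 16)
    (hν : S.encard ≤ M.eRk S + 4) : {C | M.IsCircuit C ∧ C.ncard = 4}.ncard ≤ 35 := by
  haveI : (M.restrict S).Finite := _root_.Matroid.restrict_finite (M.ground_finite.subset hS)
  rw [← setOf_isCircuit_ncard_restrict_eq hS hcov]
  refine ncard_isCircuit_four_le_of_nullity_le_four (M.restrict S) ?_ (dual_eRank_restrict_le hS hν)
  rwa [_root_.Matroid.restrict_ground_eq]

/-- The same at nullity `≤ 5` on `≤ 20` elements: at most `70` four-element circuits. -/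
theorem ncard_isCircuit_four_le_of_subset_nullity_le_five (M : _root_.Matroid α) [M.Finite] {S : Set α}
    (hS : S ⊆ M.E) (hcov : ∀ C, M.IsCircuit C → C.ncard = 4 → C ⊆ S) (hSc : S.ncard ≤ 20)
    (hν : S.encard ≤ M.eRk S + 5) : {C | M.IsCircuit C ∧ C.ncard = 4}.ncard ≤ 70 := by
  haveI : (M.restrict S).Finite := _root_.Matroid.restrict_finite (M.ground_finite.subset hS)
  rw [← setOf_isCircuit_ncard_restrict_eq hS hcov]
  refine ncard_isCircuit_four_le_of_nullity_le_five (M.restrict S) ?_ (dual_eRank_restrict_le hS hν)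
  rwa [_root_.Matroid.restrict_ground_eq]

/-- The same at nullity `≤ 6` on `≤ 24` elements: at most `312` four-element circuits. -/
theorem ncard_isCircuit_four_le_of_subset_nullity_le_six (M : _root_.Matroid α) [M.Finite] {S : Set α}
    (hS : S ⊆ M.E) (hcov : ∀ C, M.IsCircuit C → C.ncard = 4 → C ⊆ S) (hSc : S.ncard ≤ 24)
    (hν : S.encard ≤ M.eRk S + 6) : {C | M.IsCircuit C ∧ C.ncard = 4}.ncard ≤ 312 := by
  haveI : (M.restrict S).Finite := _root_.Matroid.restrict_finite (M.ground_finite.subset hS)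
  rw [← setOf_isCircuit_ncard_restrict_eq hS hcov]
  refine ncard_isCircuit_four_le_of_nullity_le_six (M.restrict S) ?_ (dual_eRank_restrict_le hS hν)
  rwa [_root_.Matroid.restrict_ground_eq]

end Matroid

end PercRepro
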